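import Summits.QuantumFields.QCD.Theses.HeatSlicedQuarks
import Summits.QuantumFields.QCD.Theorems.HeatSlicedQuarksSmallFieldUltracontractivity
import Summits.QuantumFields.QCD.Theorems.HeatSlicedQuarksInterleavedHeatSliceFlowStubRowDiffToDiag
import Summits.QuantumFields.QCD.Theorems.HeatSlicedQuarksInterleavedHeatSliceFlowStubParametrixGaugeReduction
import Summits.QuantumFields.QCD.Theorems.HeatSlicedQuarksInterleavedHeatSliceFlowStubColumnIdentificationAux

/-!
# Stub `stub_interiorAssembly` of line `Sketch` (crux `InterleavedHeatSliceFlow`, item stmt-QuantumFields-8891)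

**Interior assembly** (reshape r4): `GlobalCombGauge → ColumnIdentification → InteriorIdentification`, written out.
On a torus large enough to host the global comb gauge (`L ≥ A r²/ε`), under global `(ε/r²)²`-smallness and
`ε ≤ ε₀`, the on-diagonal heat kernel of `H_U = D_Wᴴ D_W` is the free one up to the LINEAR relative error
`C (εt/r²)/t²` for `1 ≤ t ≤ r²`.

## Proof

Put `δ := ε/r² ∈ (0,1]`.  The first hypothesis gives a gauge `g` in which every link of `W := U^g` has deficit
`≤ C_A (d(x,z)+1)² δ²`; `W` has the same plaquette deficits as `U` (8871's `stub_gaugeCovariance` (2)).  Since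
`U = (W)^{g⁻¹}`, the landed `stub_parametrixGaugeReduction` bounds the `(x,x)` colour–spin entry of `K_U − K_1` by the
sum of the nine `(x,x)` entries of `K_W − K_1`.  Each of these is handled by the T*T bridge `stub_rowDiffToDiag` at
`P = K_W(t/2)`, `Q = K_1(t/2)` (`P² = K_W(t)`): rows of the Hermitian `P − Q` are conjugate columns, bounded by the
second hypothesis (`≤ C_c δ`, `s = t/2`); `‖col P‖₂ = √(Re K_W(t)(j,j)) ≤ √C₈₈₇₁/t` (T*T for columns + the closed
crux 8871 at the site `x`); `‖row Q‖₂ ≤ |C_r|/(1 + t/2) ≤ 2|C_r|/t` (8871's `stub_freeRowBounds`).  Hence each entry is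
`≤ C_c δ (√C₈₈₇₁ + 2|C_r|)/t = C_c(√C₈₈₇₁ + 2|C_r|)·(εt/r²)/t²`, and the nine of them give the claim.
-/

noncomputable section

namespace Summit.QuantumFields.QCD.Cruxes.InterleavedHeatSliceFlow.Sketch

open Literature.MathematicalPhysics.QuantumLattice Literature.MathematicalPhysics.QuantumFieldTheory
  Literature.Probability.LatticeModels
open Summit.QuantumFields.QCD.Theses.HeatSlicedQuarks
open Summit.QuantumFields.QCD.Theorems.SmallFieldUltracontractivity.Negative
open Summit.QuantumFields.QCD.Cruxes.SmallFieldUltracontractivity.PointCentredAxialParabolic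
open scoped Matrix ComplexConjugate

/-- Undoing a gauge transformation: `(U^g)^{g⁻¹} = U`. -/
theorem gaugeTransform_inv_gaugeTransform_eq {L : ℕ} {G : Type*} [Group G] (g : TorusSite 4 L → G)
    (U : GaugeConfig 4 L G) : gaugeTransform g⁻¹ (gaugeTransform g U) = U := by
  funext e
  simp only [gaugeTransform, Pi.inv_apply, inv_inv]
  group

/-- Row and column `ℓ²` norms of a Hermitian matrix coincide. -/
theorem sum_norm_sq_row_eq_col_of_isHermitian {ι : Type} [Fintype ι] {M : Matrix ι ι ℂ} (hM : M.IsHermitian)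
    (i : ι) : ∑ k, ‖M i k‖ ^ 2 = ∑ k, ‖M k i‖ ^ 2 := by
  refine Finset.sum_congr rfl fun k _ => ?_
  conv_lhs => rw [← hM.eq]
  rw [Matrix.conjTranspose_apply, norm_star]

/-- The heat kernel at time `t` is the square of the heat kernel at time `t/2`. -/
theorem exp_neg_smul_eq_sq {ι : Type} [Fintype ι] [DecidableEq ι] (H : Matrix ι ι ℂ) (t : ℝ) :
    NormedSpace.exp (-(t : ℂ) • H) =
      NormedSpace.exp (-((t / 2 : ℝ) : ℂ) • H) * NormedSpace.exp (-((t / 2 : ℝ) : ℂ) • H) := by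
  set X : Matrix ι ι ℂ := -((t / 2 : ℝ) : ℂ) • H with hX
  have hsum : -(t : ℂ) • H = X + X := by
    rw [hX, ← add_smul]; congr 1; push_cast; ring
  rw [hsum, Matrix.exp_add_of_commute X X (Commute.refl X)]

set_option maxHeartbeats 800000 in
/-- **Stub `stub_interiorAssembly`** (M; lead c2; reshape r4): `GlobalCombGauge → ColumnIdentification →
InteriorIdentification`, all written out (see the module docstring for the proof). -/
theorem stub_interiorAssembly :
    (∃ C_A A₀ : ℝ, 0 ≤ C_A ∧ ∀ (L : ℕ) [NeZero L] (U : GaugeConfig 4 L (Matrix.specialUnitaryGroup (Fin 3) ℂ))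
      (x : TorusSite 4 L) (δ : ℝ), 0 < δ → δ ≤ 1 → A₀ / δ ≤ (L : ℝ) →
      (∀ (y : TorusSite 4 L) (μ ν : Fin 4),
        3 - ((fundamentalRep (Fin 3)) (plaquetteHolonomy U y μ ν)).trace.re ≤ δ ^ 2) →
      ∃ g : TorusSite 4 L → Matrix.specialUnitaryGroup (Fin 3) ℂ, ∀ (z : TorusSite 4 L) (μ : Fin 4),
        3 - ((fundamentalRep (Fin 3)) (gaugeTransform g U (z, μ))).trace.re ≤
          C_A * ((torusDist x z : ℝ) + 1) ^ 2 * δ ^ 2) →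
    (∀ C_A : ℝ, 0 ≤ C_A → ∃ ε₀ : ℝ, 0 < ε₀ ∧ ∃ C : ℝ, ∀ (L : ℕ) [NeZero L]
      (W : GaugeConfig 4 L (Matrix.specialUnitaryGroup (Fin 3) ℂ)) (m : ℝ), m ∈ Set.Icc (-(1 / 2 : ℝ)) 1 →
      ∀ (r : ℕ), 1 ≤ r → r ≤ L → ∀ (ε : ℝ), 0 < ε → ε ≤ ε₀ →
      (∀ (y : TorusSite 4 L) (μ ν : Fin 4),
        3 - ((fundamentalRep (Fin 3)) (plaquetteHolonomy W y μ ν)).trace.re ≤ (ε / (r : ℝ) ^ 2) ^ 2) →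
      ∀ (x : TorusSite 4 L),
      (∀ (z : TorusSite 4 L) (μ : Fin 4),
        3 - ((fundamentalRep (Fin 3)) (W (z, μ))).trace.re ≤
          C_A * ((torusDist x z : ℝ) + 1) ^ 2 * (ε / (r : ℝ) ^ 2) ^ 2) →
      ∀ (s : ℝ), 0 ≤ s → 2 * s ≤ (r : ℝ) ^ 2 → ∀ (a : Fin 3) (α : Fin 4),
        Real.sqrt (∑ q, ‖(NormedSpace.exp (-(s : ℂ) • ((wilsonDirac (fundamentalRep (Fin 3)) W m 1)ᴴ *
                wilsonDirac (fundamentalRep (Fin 3)) W m 1))) q (x, a, α) -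
              (NormedSpace.exp (-(s : ℂ) •
                ((wilsonDirac (fundamentalRep (Fin 3))
                    (fun _ : Edge 4 L => (1 : Matrix.specialUnitaryGroup (Fin 3) ℂ)) m 1)ᴴ *
                  wilsonDirac (fundamentalRep (Fin 3))
                    (fun _ : Edge 4 L => (1 : Matrix.specialUnitaryGroup (Fin 3) ℂ)) m 1))) q (x, a, α)‖ ^ 2) ≤
          C * (ε / (r : ℝ) ^ 2)) →
    (∃ ε₀ : ℝ, 0 < ε₀ ∧ ∃ A C : ℝ, ∀ (L : ℕ) [NeZero L]
      (U : GaugeConfig 4 L (Matrix.specialUnitaryGroup (Fin 3) ℂ)) (m : ℝ), m ∈ Set.Icc (-(1 / 2 : ℝ)) 1 →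
      ∀ (r : ℕ), 1 ≤ r → r ≤ L → ∀ (ε : ℝ), 0 < ε → ε ≤ ε₀ →
      (∀ (y : TorusSite 4 L) (μ ν : Fin 4),
        3 - ((fundamentalRep (Fin 3)) (plaquetteHolonomy U y μ ν)).trace.re ≤ (ε / (r : ℝ) ^ 2) ^ 2) →
      A * (r : ℝ) ^ 2 / ε ≤ (L : ℝ) →
      ∀ (t : ℝ), 1 ≤ t → t ≤ (r : ℝ) ^ 2 → ∀ (x : TorusSite 4 L) (a b : Fin 3) (α β : Fin 4),
        ‖(NormedSpace.exp (-(t : ℂ) • ((wilsonDirac (fundamentalRep (Fin 3)) U m 1)ᴴ *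
              wilsonDirac (fundamentalRep (Fin 3)) U m 1))) (x, a, α) (x, b, β) -
            (NormedSpace.exp (-(t : ℂ) •
              ((wilsonDirac (fundamentalRep (Fin 3))
                  (fun _ : Edge 4 L => (1 : Matrix.specialUnitaryGroup (Fin 3) ℂ)) m 1)ᴴ *
                wilsonDirac (fundamentalRep (Fin 3))
                  (fun _ : Edge 4 L => (1 : Matrix.specialUnitaryGroup (Fin 3) ℂ)) m 1))) (x, a, α) (x, b, β)‖ ≤
          C * (ε * t / (r : ℝ) ^ 2) / t ^ 2) := by
  intro hComb hCol
  obtain ⟨C_A, A₀, hCA, hg⟩ := hComb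
  obtain ⟨ε₁, hε₁, C_c, hc⟩ := hCol C_A hCA
  obtain ⟨ε₈, hε₈, K₈, C₈, hSFU⟩ :=
    (Cruxes.SmallFieldUltracontractivity.PointCentredAxialParabolic.SmallFieldUltracontractivity_of :
      SmallFieldUltracontractivity)
  obtain ⟨C_r, c_r, _hcr, hFR⟩ := stub_freeRowBounds (stub_freeKernelDecay stub_freeKernelFourier)
  refine ⟨min (min ε₁ ε₈) 1, lt_min (lt_min hε₁ hε₈) one_pos, max A₀ 1,
    9 * (C_c * (Real.sqrt C₈ + 2 * |C_r|)), ?_⟩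
  intro L _ U m hm r hr hrL ε hε hεle hsmall hbig t ht htr x a b α β
  -- scales
  have hr0 : (0 : ℝ) < (r : ℝ) := by exact_mod_cast (Nat.lt_of_lt_of_le Nat.zero_lt_one hr)
  have hr1 : (1 : ℝ) ≤ (r : ℝ) := by exact_mod_cast hr
  have hr2 : (0 : ℝ) < (r : ℝ) ^ 2 := by positivity
  have ht0 : 0 < t := by linarith
  have hε1 : ε ≤ 1 := hεle.trans (min_le_right _ _)
  have hεε₁ : ε ≤ ε₁ := hεle.trans ((min_le_left _ _).trans (min_le_left _ _))
  have hεε₈ : ε ≤ ε₈ := hεle.trans ((min_le_left _ _).trans (min_le_right _ _))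
  set δ : ℝ := ε / (r : ℝ) ^ 2 with hδ
  have hδ0 : 0 < δ := div_pos hε hr2
  have hδ1 : δ ≤ 1 := by
    rw [hδ, div_le_one hr2]; nlinarith
  have hL : A₀ / δ ≤ (L : ℝ) := by
    refine le_trans ?_ hbig
    rw [hδ, div_div_eq_mul_div]
    exact div_le_div_of_nonneg_right (mul_le_mul_of_nonneg_right (le_max_left _ _) hr2.le) hε.le
  -- the global comb gauge
  obtain ⟨g, hprof⟩ := hg L U x δ hδ0 hδ1 hL (fun y μ ν => by rw [hδ]; exact hsmall y μ ν)
  set W : GaugeConfig 4 L (Matrix.specialUnitaryGroup (Fin 3) ℂ) := gaugeTransform g U with hW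
  have hsmallW : ∀ (y : TorusSite 4 L) (μ ν : Fin 4),
      3 - ((fundamentalRep (Fin 3)) (plaquetteHolonomy W y μ ν)).trace.re ≤ (ε / (r : ℝ) ^ 2) ^ 2 := by
    intro y μ ν
    rw [hW, (stub_gaugeCovariance L U g m t y).2 μ ν]
    exact hsmall y μ ν
  -- notation for the kernels
  set D : Matrix (TorusSite 4 L × Fin 3 × Fin 4) (TorusSite 4 L × Fin 3 × Fin 4) ℂ :=
    wilsonDirac (fundamentalRep (Fin 3)) W m 1 with hD
  set D₁ : Matrix (TorusSite 4 L × Fin 3 × Fin 4) (TorusSite 4 L × Fin 3 × Fin 4) ℂ :=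
    wilsonDirac (fundamentalRep (Fin 3)) (fun _ : Edge 4 L => (1 : Matrix.specialUnitaryGroup (Fin 3) ℂ)) m 1
    with hD₁
  set P : Matrix _ _ ℂ := NormedSpace.exp (-((t / 2 : ℝ) : ℂ) • (Dᴴ * D)) with hP
  set Q : Matrix _ _ ℂ := NormedSpace.exp (-((t / 2 : ℝ) : ℂ) • (D₁ᴴ * D₁)) with hQ
  have hPherm : P.IsHermitian := isHermitian_exp_neg_smul D (t / 2)
  have hQherm : Q.IsHermitian := isHermitian_exp_neg_smul D₁ (t / 2)
  have hPQherm : (P - Q).IsHermitian := hPherm.sub hQherm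
  -- (1) columns of `P - Q` (the second hypothesis at `s = t/2`)
  have hcolPQ : ∀ (a' : Fin 3) (α' : Fin 4),
      Real.sqrt (∑ k, ‖P k (x, a', α') - Q k (x, a', α')‖ ^ 2) ≤ C_c * δ := by
    intro a' α'
    have h := hc L W m hm r hr hrL ε hε hεε₁ hsmallW x (fun z μ => by rw [← hδ]; exact hprof z μ) (t / 2)
      (by linarith) (by linarith) a' α'
    rw [hδ]; exact h
  have hCcδ : 0 ≤ C_c * δ := (Real.sqrt_nonneg _).trans (hcolPQ a α)
  have hrowPQ : ∀ (a' : Fin 3) (α' : Fin 4),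
      Real.sqrt (∑ k, ‖P (x, a', α') k - Q (x, a', α') k‖ ^ 2) ≤ C_c * δ := by
    intro a' α'
    have heq : ∑ k, ‖P (x, a', α') k - Q (x, a', α') k‖ ^ 2 = ∑ k, ‖P k (x, a', α') - Q k (x, a', α')‖ ^ 2 := by
      have := sum_norm_sq_row_eq_col_of_isHermitian hPQherm (x, a', α')
      simpa only [Matrix.sub_apply] using this
    rw [heq]; exact hcolPQ a' α'
  -- (2) columns of `P` (T*T + the closed crux 8871 at the site `x`)
  have hcolP : ∀ (b' : Fin 3) (β' : Fin 4), Real.sqrt (∑ k, ‖P k (x, b', β')‖ ^ 2) ≤ Real.sqrt C₈ / t := by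
    intro b' β'
    have hTT := sum_norm_sq_col_eq_re_apply_self D (t / 2) (x, b', β')
    rw [show (2 * (t / 2) : ℝ) = t by ring] at hTT
    have hsfu := hSFU L W m hm x r hr hrL (fun y' _ μ ν => (hsmallW y' μ ν).trans (by
      have h1' : 0 ≤ ε / (r : ℝ) ^ 2 := div_nonneg hε.le hr2.le
      exact pow_le_pow_left₀ h1' (div_le_div_of_nonneg_right hεε₈ hr2.le) 2)) t ht htr b' b' β' β'
    have hre : ((NormedSpace.exp (-(t : ℂ) • (Dᴴ * D))) (x, b', β') (x, b', β')).re ≤ C₈ / t ^ 2 :=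
      (Complex.re_le_norm _).trans (by exact_mod_cast hsfu)
    calc Real.sqrt (∑ k, ‖P k (x, b', β')‖ ^ 2) ≤ Real.sqrt (C₈ / t ^ 2) := Real.sqrt_le_sqrt (by rw [hTT]; exact hre)
      _ = Real.sqrt C₈ / t := by rw [Real.sqrt_div' _ (sq_nonneg _), Real.sqrt_sq ht0.le]
  -- (3) rows of `Q` (8871's free row bound)
  have hrowQ : ∀ (a' : Fin 3) (α' : Fin 4), Real.sqrt (∑ k, ‖Q (x, a', α') k‖ ^ 2) ≤ 2 * |C_r| / t := by
    intro a' α'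
    have hL1 : (r : ℝ) ≤ (L : ℝ) := by exact_mod_cast hrL
    have htL : t / 2 ≤ (L : ℝ) ^ 2 := by nlinarith
    have h := (hFR L m hm (t / 2) (by linarith) htL x a' α').1
    calc Real.sqrt (∑ k, ‖Q (x, a', α') k‖ ^ 2) ≤ Real.sqrt ((C_r / (1 + t / 2)) ^ 2) := Real.sqrt_le_sqrt h
      _ = |C_r| / (1 + t / 2) := by rw [Real.sqrt_sq_eq_abs, abs_div, abs_of_pos (by linarith : (0 : ℝ) < 1 + t / 2)]
      _ ≤ 2 * |C_r| / t := by
          rw [div_le_div_iff₀ (by linarith) ht0]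
          nlinarith [abs_nonneg C_r]
  -- (4) each gauged entry by the T*T bridge
  have hentry : ∀ (a' b' : Fin 3),
      ‖(NormedSpace.exp (-(t : ℂ) • (Dᴴ * D))) (x, a', α) (x, b', β) -
          (NormedSpace.exp (-(t : ℂ) • (D₁ᴴ * D₁))) (x, a', α) (x, b', β)‖ ≤
        C_c * (Real.sqrt C₈ + 2 * |C_r|) * (δ / t) := by
    intro a' b'
    rw [exp_neg_smul_eq_sq (Dᴴ * D) t, exp_neg_smul_eq_sq (D₁ᴴ * D₁) t]
    refine (stub_rowDiffToDiag _ P Q (x, a', α) (x, b', β)).trans ?_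
    have h1 := mul_le_mul (hrowPQ a' α) (hcolP b' β) (Real.sqrt_nonneg _) hCcδ
    have h2 := mul_le_mul (hrowQ a' α) (hcolPQ b' β) (Real.sqrt_nonneg _)
      ((Real.sqrt_nonneg _).trans (hrowQ a' α))
    refine (add_le_add h1 h2).trans (le_of_eq ?_)
    ring
  -- (5) gauge reduction and the nine entries
  have hU : U = gaugeTransform g⁻¹ W := by rw [hW, gaugeTransform_inv_gaugeTransform_eq]
  have hred := stub_parametrixGaugeReduction L g⁻¹ W m t x a b α β
  rw [← hU] at hred
  refine hred.trans ?_
  calc ∑ a' : Fin 3, ∑ b' : Fin 3,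
        ‖(NormedSpace.exp (-(t : ℂ) • (Dᴴ * D))) (x, a', α) (x, b', β) -
          (NormedSpace.exp (-(t : ℂ) • (D₁ᴴ * D₁))) (x, a', α) (x, b', β)‖
      ≤ ∑ _a' : Fin 3, ∑ _b' : Fin 3, C_c * (Real.sqrt C₈ + 2 * |C_r|) * (δ / t) :=
        Finset.sum_le_sum fun a' _ => Finset.sum_le_sum fun b' _ => hentry a' b'
    _ = 9 * (C_c * (Real.sqrt C₈ + 2 * |C_r|)) * (ε * t / (r : ℝ) ^ 2) / t ^ 2 := by
        simp only [Finset.sum_const, Finset.card_univ, Fintype.card_fin, nsmul_eq_mul]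
        rw [hδ]
        field_simp
        ring

end Summit.QuantumFields.QCD.Cruxes.InterleavedHeatSliceFlow.Sketch

end
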